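import Literature.IUT.HodgeTheaters.TemperedCoveringsChartsAtCountable
import HarnessLib

/-!
# [IUTchI] Prop. 2.1 / 2.2 BY NAME, [SemiAnbd] Thm 3.7 (iii) AT THE ONE GRAPH `𝒢`, NO Galois domination / (RF)

Mochizuki, *Inter-universal Teichmüller theory I*, kurims manuscript (May 2020), §2, Proposition 2.1
"Profinite Conjugates of Nontrivial Compact Subgroups" and Proposition 2.2, p. 45
[cite: Mochizuki2012, Prop 2.1 p.45] (D-0012 claim key; series status DISPUTED; nothing of the
series is asserted here).

PROOF-ONLY companion of `TemperedCoveringsProTreeCountable.lean` (abc-iut-L5-t11 lineage) and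
`TemperedCoveringsChartsAtCountable.lean` (abc-iut-w5-d111) in the φ2 programme (abc-iut-L3-d1, L3-lead
rulings α4-3 / α13-2, L5-lead RULINGS #22 (1)): the two remaining [IUTchI] Prop 2.1 / 2.2 kernels of
`TemperedCoveringsProTreeCountable.lean` that still bind the ∀-countable named fact
`CompactInVerticial.{u}` ([SemiAnbd] Thm 3.7 (iii) for EVERY countable graph, F-1732 — OPEN as typed),
namely the BY-NAME forms `prop21_of_chart_of_isProfiniteCompletion'` /
`tp_isCommensurablyTerminal_of_chart_of_isProfiniteCompletion'` (Galois domination / (RF) already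
dropped there), are re-derived with the binder replaced by the PER-GRAPH form
`(hCV : CompactInVerticialAt 𝒢)` ([SemiAnbd] Thm 3.7 (iii) at the one graph the proof instantiates).
Port rule α4-3: statement otherwise byte-identical, decl suffix `_at` (the prime of the original kept
last: `…_at'`), originals untouched.  Proofs: `hPC.t2Space` + d111's `prop21_of_chart_at'` /
`tp_isCommensurablyTerminal_of_chart_at'`.  Typed ≠ proved; nothing here bears on [IUTchIII] Cor. 3.12.
-/

noncomputable section

namespace Literature.IUT.HodgeTheaters

open Pointwise Filter
open _root_.Topology
open Literature.AnabelianGeometry.SemiGraphs (IsTempered IsProfiniteCompletion ProfiniteSemiGraph)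
open Literature.AnabelianGeometry.SemiGraphs.ProfiniteSemiGraph (TemperedPiChart verticialSubgroups
  CompactInVerticialAt VerticialInjective)
open Literature.AnabelianGeometry.AbsoluteAnabelian (IsCommensurablyTerminal)

universe u

namespace TemperedGraphGroupData

variable (D : TemperedGraphGroupData.{u}) {𝒢 : ProfiniteSemiGraph.{u}}

/-- **[IUTchI] Proposition 2.1 AS TYPED, every [SemiAnbd] input BY NAME, Thm 3.7 (iii) AT `𝒢`, WITHOUT
Galois domination / (RF)**: per-graph twin of `prop21_of_chart_of_isProfiniteCompletion'` — inputs: a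
chart `c` of `π₁^temp(𝒢)` identified with `Π^tp_𝔾` along `e`, the Thm 3.7 hypotheses of `𝒢`,
`CompactInVerticialAt 𝒢` ([SemiAnbd] Thm 3.7 (iii) at `𝒢` only), `Π̂_𝔾` the profinite completion of
`Π^tp_𝔾` (used only for the Hausdorffness of `Π̂_𝔾`), a verticial family, node data + (A3); step (A0)
from the chart's Galois-countability. ([IUTchI] Prop 2.1 p.45) [cite: Mochizuki2012, Prop 2.1 p.45]
[claim: Mochizuki2012, status: disputed] -/
theorem prop21_of_chart_of_isProfiniteCompletion_at' (c : TemperedPiChart 𝒢) (e : D.Tp ≃ₜ* c.G)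
    (h𝒢 : 𝒢.Thm37Hypotheses) (hCV : CompactInVerticialAt 𝒢)
    (hPC : IsProfiniteCompletion
      ({ toMonoidHom := D.ι, continuous_toFun := D.ι_continuous } : D.Tp →ₜ* D.Hat))
    (Λv : 𝒢.graph.Vertex → Subgroup D.Tp)
    (hΛv : ∀ v, (Λv v).map (e : D.Tp →* c.G) ∈ verticialSubgroups c v)
    {E : Type*} (src tgt : E → 𝒢.graph.Vertex) (c₁ c₂ : E → D.Tp)
    (hA3 : ∀ (v w : 𝒢.graph.Vertex) (g h : D.Hat),
      MulAut.conj g • (Λv v).map D.ι ⊓ MulAut.conj h • (Λv w).map D.ι ≠ ⊥ →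
        (v = w ∧ g⁻¹ * h ∈ (Λv v).map D.ι) ∨
        ∃ (e : E) (k : D.Hat), ∃ p ∈ (Λv (src e)).map D.ι, ∃ q ∈ (Λv (tgt e)).map D.ι,
          (src e = v ∧ tgt e = w ∧ g = k * D.ι (c₁ e) * p ∧ h = k * D.ι (c₂ e) * q) ∨
          (src e = w ∧ tgt e = v ∧ h = k * D.ι (c₁ e) * p ∧ g = k * D.ι (c₂ e) * q)) :
    D.ProfiniteConjugatesOfCompactSubgroups := by
  haveI : T2Space D.Hat := hPC.t2Space
  exact D.prop21_of_chart_at' c e h𝒢 hCV Λv hΛv src tgt c₁ c₂ hA3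

/-- **[IUTchI] Proposition 2.2 ("`Π^tp_𝔾` is commensurably terminal in `Π̂_𝔾`"), every [SemiAnbd] input
BY NAME, Thm 3.7 (iii) AT `𝒢`, WITHOUT Galois domination / (RF)**: per-graph twin of
`tp_isCommensurablyTerminal_of_chart_of_isProfiniteCompletion'` (`CompactInVerticialAt 𝒢` in place of
the ∀-countable `CompactInVerticial`; `VerticialInjective` = Thm 3.7 (i) kept as the original's binder).
([IUTchI] Prop 2.2 p.45) [cite: Mochizuki2012, Prop 2.2 p.45] [claim: Mochizuki2012, status: disputed] -/
theorem tp_isCommensurablyTerminal_of_chart_of_isProfiniteCompletion_at' (c : TemperedPiChart 𝒢)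
    (e : D.Tp ≃ₜ* c.G) (h𝒢 : 𝒢.Thm37Hypotheses)
    (hCV : CompactInVerticialAt 𝒢) (hVI : VerticialInjective.{u})
    (hPC : IsProfiniteCompletion
      ({ toMonoidHom := D.ι, continuous_toFun := D.ι_continuous } : D.Tp →ₜ* D.Hat))
    (Λv : 𝒢.graph.Vertex → Subgroup D.Tp)
    (hΛv : ∀ v, (Λv v).map (e : D.Tp →* c.G) ∈ verticialSubgroups c v)
    {E : Type*} (src tgt : E → 𝒢.graph.Vertex) (c₁ c₂ : E → D.Tp)
    (hA3 : ∀ (v w : 𝒢.graph.Vertex) (g h : D.Hat),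
      MulAut.conj g • (Λv v).map D.ι ⊓ MulAut.conj h • (Λv w).map D.ι ≠ ⊥ →
        (v = w ∧ g⁻¹ * h ∈ (Λv v).map D.ι) ∨
        ∃ (e : E) (k : D.Hat), ∃ p ∈ (Λv (src e)).map D.ι, ∃ q ∈ (Λv (tgt e)).map D.ι,
          (src e = v ∧ tgt e = w ∧ g = k * D.ι (c₁ e) * p ∧ h = k * D.ι (c₂ e) * q) ∨
          (src e = w ∧ tgt e = v ∧ h = k * D.ι (c₁ e) * p ∧ g = k * D.ι (c₂ e) * q)) :
    IsCommensurablyTerminal D.ι.range := by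
  haveI : T2Space D.Hat := hPC.t2Space
  exact D.tp_isCommensurablyTerminal_of_chart_at' c e h𝒢 hCV hVI Λv hΛv src tgt c₁ c₂ hA3

/-- **[IUTchI] Rmk 2.2.2 / Prop 2.2 "in particular": `Π^tp_𝔾` is NORMALLY terminal in `Π̂_𝔾`**, BY NAME,
Thm 3.7 (iii) AT `𝒢`, WITHOUT Galois domination / (RF) — the `TemperedNormallyTerminal` packaging of
`tp_isCommensurablyTerminal_of_chart_of_isProfiniteCompletion_at'` (commensurably terminal ⇒ normally
terminal). ([IUTchI] Rmk 2.2.2 p.46) [cite: Mochizuki2012, Rmk 2.2.2 p.46]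
[claim: Mochizuki2012, status: disputed] -/
theorem temperedNormallyTerminal_of_chart_of_isProfiniteCompletion_at' (c : TemperedPiChart 𝒢)
    (e : D.Tp ≃ₜ* c.G) (h𝒢 : 𝒢.Thm37Hypotheses)
    (hCV : CompactInVerticialAt 𝒢) (hVI : VerticialInjective.{u})
    (hPC : IsProfiniteCompletion
      ({ toMonoidHom := D.ι, continuous_toFun := D.ι_continuous } : D.Tp →ₜ* D.Hat))
    (Λv : 𝒢.graph.Vertex → Subgroup D.Tp)
    (hΛv : ∀ v, (Λv v).map (e : D.Tp →* c.G) ∈ verticialSubgroups c v)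
    {E : Type*} (src tgt : E → 𝒢.graph.Vertex) (c₁ c₂ : E → D.Tp)
    (hA3 : ∀ (v w : 𝒢.graph.Vertex) (g h : D.Hat),
      MulAut.conj g • (Λv v).map D.ι ⊓ MulAut.conj h • (Λv w).map D.ι ≠ ⊥ →
        (v = w ∧ g⁻¹ * h ∈ (Λv v).map D.ι) ∨
        ∃ (e : E) (k : D.Hat), ∃ p ∈ (Λv (src e)).map D.ι, ∃ q ∈ (Λv (tgt e)).map D.ι,
          (src e = v ∧ tgt e = w ∧ g = k * D.ι (c₁ e) * p ∧ h = k * D.ι (c₂ e) * q) ∨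
          (src e = w ∧ tgt e = v ∧ h = k * D.ι (c₁ e) * p ∧ g = k * D.ι (c₂ e) * q)) :
    D.TemperedNormallyTerminal :=
  ⟨fun _ => (D.tp_isCommensurablyTerminal_of_chart_of_isProfiniteCompletion_at' c e h𝒢 hCV hVI hPC Λv
    hΛv src tgt c₁ c₂ hA3).isNormallyTerminal⟩

end TemperedGraphGroupData

end Literature.IUT.HodgeTheaters

end
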